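/-
Copyright (c) 2026 the pub-hodgecm-mathlib formalisation cell (harness21).  Prover seat hodgecm-mathlib-K2E4-p21 (g2), Track B «K2-LIT» ∕ h413,
line (ii′) «H-side central germ expansion» (lead K2E4-p06 (g2)), letter (DUAL_z) «dual pieces at the central-unipotent classes of `H_v`» ((E4) ‹DUAL₂›).  2026-09-04.
-/
import Literature.NumberTheory.Rogawski1990.UnitaryTwoOneCentralUnipotentStrataCM          -- ★ p23 (E2b) «STRATA₂» on `H_v` at a central `z`: `centralUnipotent_conj_iff`, (S2₂) `exists_isOpen_forall_centralUnipotent_mem_iff_isConj`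
import Literature.NumberTheory.Rogawski1990.UnipotentOrbitalIntegralDualPiecesOfStrataCM   -- ★ F0P3a-p04: generic `exists_isOpen_isCompact_isClosed_nhds_subset`, `exists_indicator_det_classOrbitalIntegral_ne_zero_of_strata` (+ ★ DUAL inversion ∕ total dress, ★ `nonarchimedeanGroup_cmLocal`)
import Literature.NumberTheory.Automorphic.UnitaryResiduallyRegularOrbitalIntegral         -- ★ `isCompact_isOpen_cmLocalIntegralLevel_prod` (`K₂ × K₁` compact open in `H_v`)
import Literature.NumberTheory.Rogawski1990.TamagawaSingularMembersFinTFCovol               -- ★ frame vocabulary of the U3b prefix (as the cand)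
import Literature.NumberTheory.Weil1982.UnitaryFinCentralizerTopFormHaar
import Literature.NumberTheory.Rogawski1990.FinExplicitTransferFactorConjLeft
import Literature.NumberTheory.Rogawski1990.FinExplicitTransferFactorConjRight
import Literature.NumberTheory.Rogawski1990.ArchCanonicalTransferFactor
import Literature.NumberTheory.Rogawski1990.ExplicitFactorProductFormula
import Literature.NumberTheory.Automorphic.QuadraticHeckeCharacterCM
import HarnessLib

/-!
# K2 · E3 · line (ii′) — (DUAL_z) DUAL PIECES at the central-unipotent classes of `H_v = U(Φ₂)(L⁺_v) × U(Φ₁)(L⁺_v)`, every non-split `v`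
# [Rogawski1990 §8.1 proof of Prop. 8.1.1 p. 113 l. 1–6; §3.9 p. 32; Bernstein–Zelevinsky 1976 §1.5, §6]

Cell `pub/hodgecm-mathlib` (D-0151), crux H413 = `stmt-HodgeConjecture-24833` (lane `--supports … --as helper`), route HCCMUnconditional; Track B «K2-LIT»,
E3 module `Cruxes/H413/Lines/K2_E3_EllipticInputsSigs_U3bCentralGerms.lean`, line (ii′) (lead K2E4-p06 (g2)); seat K2E4-p21 (g2), brick (E4) ‹DUAL₂› of the (E) programme
(K2E3-p23 (g2): (E1) ★ p855739, (E2) ★ p855772 ∕ ★ `UnitaryTwoOneCentralUnipotentStrataCM`), consumed by K2E4-p18 (g3)'s ★ `K2E3CentralGermHomogeneityRayOfReference`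
(`‹DUAL_z› → ‹HOM-ray*› → ‹HOM-ray›`).  THEOREMS ONLY (no definition, no instance, no notation, no named fact, no `sorry`); ★-only imports.

THE MATHEMATICS.  Print: «let `f_j ∈ C(G)` be such that `Φ(u_k, f_j) = δ_{jk}`».  At a central `z ∈ H_v` the classes over `z` (`((γ z⁻¹).1 − 1)² = 0 ∧ (γ z⁻¹).2 = 1`) form TWO
strata — the point `{z}` and the regular-unipotent classes `z·(n(t), 1)` — each class being OPEN inside its stratum (★ (S2₂)).  Feeding ★ F0P3a-p04's abstract
Bernstein–Zelevinsky lemma `exists_indicator_det_classOrbitalIntegral_ne_zero_of_strata` with `R := {γ over z}` (class-stable, ★ `centralUnipotent_conj_iff`), the stratum index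
`st γ := if γ = z then 0 else 1`, `lower x := if x = z then ∅ else {z}`, the (S2₂) sets, and compact-open neighbourhoods in the non-archimedean `H_v` (Mathlib
`Prod.instNonarchimedeanGroup`, ★ `nonarchimedeanGroup_cmLocal`, ★ `isCompact_isOpen_cmLocalIntegralLevel_prod`) gives reference pieces with an invertible orbital-integral table; ★
`exists_dualPieces_of_det_ne_zero` inverts and ★ `exists_dualPieces_total_of_subtype` re-dresses.

* `centralUnipotentDualPieces` : ‹(DUAL_z) `sig_K2E3CentralUnipotentDualPieces`› (K2E4-p18 (g3) cand f5db471200e2a663, r01-boxed; bytes VERBATIM) at EVERY non-split `v`.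
HONEST LABEL: count-neutral helper until the dealer hosts (DUAL_z); HC_CM is proved only modulo the 7 printed citations (2 remaining named inputs: hLiu418 =
`stmt-HodgeConjecture-24832`, h413 = `stmt-HodgeConjecture-24833`) until rung 0 closes.

## References
* [Rogawski1990] J. D. Rogawski, *Automorphic Representations of Unitary Groups in Three Variables*, Ann. of Math. Stud. 123 (1990): §8.1, proof of Prop. 8.1.1 p. 113 (l. 1–6);
  §3.9 Prop. 3.9.1 p. 32; §4.9 p. 54.
* [BernsteinZelevinsky1976] I. N. Bernstein, A. V. Zelevinsky, *Representations of the group GL(n, F) where F is a non-archimedean local field*, Russian Math. Surveys 31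
  (1976), §1.5, §6.
* [HarishChandra1999AdmissibleDistributions] Harish-Chandra (DeBacker–Sally), *Admissible Invariant Distributions on Reductive p-adic Groups*, ULS 16 (1999), §3.1 p. 17.
-/

set_option autoImplicit false
-- the mandated namespace has the single-problem summit's repeated segment (`HodgeConjecture.HodgeConjecture`)
set_option linter.dupNamespace false

noncomputable section

open Filter Topology
open MeasureTheory Measure NumberField IsDedekindDomain
open Literature.MeasureTheory.Group
open Literature.NumberTheory.Rogawski1990 Literature.NumberTheory.Automorphic
open Literature.AlgebraicGeometry.ShimuraVarieties (unitaryGroup hermForm)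
open scoped Matrix MatrixGroups

namespace Summit.HodgeConjecture.HodgeConjecture.Cruxes.H413.K2E3CentralUnipotentDualPieces

set_option maxHeartbeats 800000 in
set_option synthInstance.maxHeartbeats 200000 in
-- HB: statement-heavy carrier (H-side prefix of U3b) plus the abstract stratification bookkeeping in one declaration
/-- **(DUAL_z) DUAL PIECES AT THE CENTRAL-UNIPOTENT CLASSES OF `H_v`** — pays `U3bCentralGerms.sig_K2E3CentralUnipotentDualPieces` (bytes VERBATIM) at EVERY non-split `v`:
for central `z ∈ H_v`, a finite set `S` of classes over `z`, and a family `mU` admissible on `S` integrating the smooth functions, there are `fd u ∈ C_c^∞(H_v)` with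
`Φ_{mU}(u, fd u) = 1` and `Φ_{mU}(u, fd u′) = 0` for `u ≠ u′` in `S`.  Proof: ★ abstract Bernstein–Zelevinsky reference pieces over the two strata `{z}` ∕ `{over z} ∖ {z}`
(★ (S2₂)), ★ matrix inversion, ★ total re-dress. [cite: Rogawski1990, §8.1 proof of Prop. 8.1.1 p. 113 l. 1–6; §3.9 p. 32]
[cite: BernsteinZelevinsky1976, §1.5, §6] [cite: HarishChandra1999AdmissibleDistributions, §3.1 p. 17] -/
theorem centralUnipotentDualPieces :
    ∀ (L : Type) [Field L] [NumberField L] [IsCMField L] (v : HeightOneSpectrum (𝓞 ↥(maximalRealSubfield L)))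
      [MeasurableSpace ((UnitaryGroup.cmDatum L 2 (Matrix.of fun i j : Fin 2 => if i.val + j.val + 1 = 2 then (1 : L) else 0)).Local v × (UnitaryGroup.cmDatum L 1 (Matrix.of fun i j : Fin 1 => if i.val + j.val + 1 = 1 then (1 : L) else 0)).Local v)] [BorelSpace ((UnitaryGroup.cmDatum L 2 (Matrix.of fun i j : Fin 2 => if i.val + j.val + 1 = 2 then (1 : L) else 0)).Local v × (UnitaryGroup.cmDatum L 1 (Matrix.of fun i j : Fin 1 => if i.val + j.val + 1 = 1 then (1 : L) else 0)).Local v)]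
      [∀ a : (UnitaryGroup.cmDatum L 2 (Matrix.of fun i j : Fin 2 => if i.val + j.val + 1 = 2 then (1 : L) else 0)).Local v × (UnitaryGroup.cmDatum L 1 (Matrix.of fun i j : Fin 1 => if i.val + j.val + 1 = 1 then (1 : L) else 0)).Local v,
        MeasurableSpace (((UnitaryGroup.cmDatum L 2 (Matrix.of fun i j : Fin 2 => if i.val + j.val + 1 = 2 then (1 : L) else 0)).Local v × (UnitaryGroup.cmDatum L 1 (Matrix.of fun i j : Fin 1 => if i.val + j.val + 1 = 1 then (1 : L) else 0)).Local v) ⧸ Subgroup.centralizer ({a} : Set ((UnitaryGroup.cmDatum L 2 (Matrix.of fun i j : Fin 2 => if i.val + j.val + 1 = 2 then (1 : L) else 0)).Local v × (UnitaryGroup.cmDatum L 1 (Matrix.of fun i j : Fin 1 => if i.val + j.val + 1 = 1 then (1 : L) else 0)).Local v)))]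
      [∀ a : (UnitaryGroup.cmDatum L 2 (Matrix.of fun i j : Fin 2 => if i.val + j.val + 1 = 2 then (1 : L) else 0)).Local v × (UnitaryGroup.cmDatum L 1 (Matrix.of fun i j : Fin 1 => if i.val + j.val + 1 = 1 then (1 : L) else 0)).Local v,
        BorelSpace (((UnitaryGroup.cmDatum L 2 (Matrix.of fun i j : Fin 2 => if i.val + j.val + 1 = 2 then (1 : L) else 0)).Local v × (UnitaryGroup.cmDatum L 1 (Matrix.of fun i j : Fin 1 => if i.val + j.val + 1 = 1 then (1 : L) else 0)).Local v) ⧸ Subgroup.centralizer ({a} : Set ((UnitaryGroup.cmDatum L 2 (Matrix.of fun i j : Fin 2 => if i.val + j.val + 1 = 2 then (1 : L) else 0)).Local v × (UnitaryGroup.cmDatum L 1 (Matrix.of fun i j : Fin 1 => if i.val + j.val + 1 = 1 then (1 : L) else 0)).Local v)))],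
      Subsingleton (UnitaryGroup.PlacesOver L v) →
    ∀ z : (UnitaryGroup.cmDatum L 2 (Matrix.of fun i j : Fin 2 => if i.val + j.val + 1 = 2 then (1 : L) else 0)).Local v × (UnitaryGroup.cmDatum L 1 (Matrix.of fun i j : Fin 1 => if i.val + j.val + 1 = 1 then (1 : L) else 0)).Local v, z ∈ Subgroup.center ((UnitaryGroup.cmDatum L 2 (Matrix.of fun i j : Fin 2 => if i.val + j.val + 1 = 2 then (1 : L) else 0)).Local v × (UnitaryGroup.cmDatum L 1 (Matrix.of fun i j : Fin 1 => if i.val + j.val + 1 = 1 then (1 : L) else 0)).Local v) →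
    ∀ (S : Finset (ConjClasses ((UnitaryGroup.cmDatum L 2 (Matrix.of fun i j : Fin 2 => if i.val + j.val + 1 = 2 then (1 : L) else 0)).Local v × (UnitaryGroup.cmDatum L 1 (Matrix.of fun i j : Fin 1 => if i.val + j.val + 1 = 1 then (1 : L) else 0)).Local v))) (mU : OrbitalMeasureFamily ((UnitaryGroup.cmDatum L 2 (Matrix.of fun i j : Fin 2 => if i.val + j.val + 1 = 2 then (1 : L) else 0)).Local v × (UnitaryGroup.cmDatum L 1 (Matrix.of fun i j : Fin 1 => if i.val + j.val + 1 = 1 then (1 : L) else 0)).Local v)),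
      (∀ u ∈ S, ((((Quotient.out u * z⁻¹).1).val : GL (Fin 2) (UnitaryGroup.LocalRing L v)).val - 1) ^ 2 = 0 ∧ (Quotient.out u * z⁻¹).2 = 1) →
      mU.IsAdmissibleOn (fun γ : (UnitaryGroup.cmDatum L 2 (Matrix.of fun i j : Fin 2 => if i.val + j.val + 1 = 2 then (1 : L) else 0)).Local v × (UnitaryGroup.cmDatum L 1 (Matrix.of fun i j : Fin 1 => if i.val + j.val + 1 = 1 then (1 : L) else 0)).Local v => ConjClasses.mk γ ∈ S) →
      (∀ u ∈ S, ∀ fH : (UnitaryGroup.cmDatum L 2 (Matrix.of fun i j : Fin 2 => if i.val + j.val + 1 = 2 then (1 : L) else 0)).Local v × (UnitaryGroup.cmDatum L 1 (Matrix.of fun i j : Fin 1 => if i.val + j.val + 1 = 1 then (1 : L) else 0)).Local v → ℂ, IsLocSmooth fH →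
        Integrable (descConj (Quotient.out u : (UnitaryGroup.cmDatum L 2 (Matrix.of fun i j : Fin 2 => if i.val + j.val + 1 = 2 then (1 : L) else 0)).Local v × (UnitaryGroup.cmDatum L 1 (Matrix.of fun i j : Fin 1 => if i.val + j.val + 1 = 1 then (1 : L) else 0)).Local v) (Subgroup.centralizer ({(Quotient.out u : (UnitaryGroup.cmDatum L 2 (Matrix.of fun i j : Fin 2 => if i.val + j.val + 1 = 2 then (1 : L) else 0)).Local v × (UnitaryGroup.cmDatum L 1 (Matrix.of fun i j : Fin 1 => if i.val + j.val + 1 = 1 then (1 : L) else 0)).Local v)} : Set ((UnitaryGroup.cmDatum L 2 (Matrix.of fun i j : Fin 2 => if i.val + j.val + 1 = 2 then (1 : L) else 0)).Local v × (UnitaryGroup.cmDatum L 1 (Matrix.of fun i j : Fin 1 => if i.val + j.val + 1 = 1 then (1 : L) else 0)).Local v)))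
          (fun _ hg => Subgroup.mem_centralizer_singleton_iff.1 hg) fH) (mU u)) →
    ∃ fd : ConjClasses ((UnitaryGroup.cmDatum L 2 (Matrix.of fun i j : Fin 2 => if i.val + j.val + 1 = 2 then (1 : L) else 0)).Local v × (UnitaryGroup.cmDatum L 1 (Matrix.of fun i j : Fin 1 => if i.val + j.val + 1 = 1 then (1 : L) else 0)).Local v) → ((UnitaryGroup.cmDatum L 2 (Matrix.of fun i j : Fin 2 => if i.val + j.val + 1 = 2 then (1 : L) else 0)).Local v × (UnitaryGroup.cmDatum L 1 (Matrix.of fun i j : Fin 1 => if i.val + j.val + 1 = 1 then (1 : L) else 0)).Local v) → ℂ,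
      (∀ u ∈ S, IsLocSmooth (fd u)) ∧ (∀ u ∈ S, classOrbitalIntegral mU (fd u) u = 1) ∧
      (∀ u ∈ S, ∀ u' ∈ S, u ≠ u' → classOrbitalIntegral mU (fd u') u = 0) := by
  intro L _ _ _ v _ _ _ _ hsub z hz S mU hS hmU hRao
  classical
  obtain ⟨w⟩ : Nonempty (UnitaryGroup.PlacesOver L v) := inferInstance
  -- `H_v` is non-archimedean; `K₂ × K₁` is a compact open subgroup: compact-open neighbourhoods everywhere
  haveI : NonarchimedeanGroup ((UnitaryGroup.cmDatum L 2 (Matrix.of fun i j : Fin 2 => if i.val + j.val + 1 = 2 then (1 : L) else 0)).Local v) := UnitaryGroup.nonarchimedeanGroup_cmLocal L 2 v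
  haveI : NonarchimedeanGroup ((UnitaryGroup.cmDatum L 1 (Matrix.of fun i j : Fin 1 => if i.val + j.val + 1 = 1 then (1 : L) else 0)).Local v) := UnitaryGroup.nonarchimedeanGroup_cmLocal L 1 v
  obtain ⟨hKc, hKo⟩ := UnitaryGroup.isCompact_isOpen_cmLocalIntegralLevel_prod L 2 1 (Matrix.of fun i j : Fin 2 => if i.val + j.val + 1 = 2 then (1 : L) else 0) (Matrix.of fun i j : Fin 1 => if i.val + j.val + 1 = 1 then (1 : L) else 0) v
  have hKcl := ((UnitaryGroup.cmLocalIntegralLevel L 2 (Matrix.of fun i j : Fin 2 => if i.val + j.val + 1 = 2 then (1 : L) else 0) v).prod (UnitaryGroup.cmLocalIntegralLevel L 1 (Matrix.of fun i j : Fin 1 => if i.val + j.val + 1 = 1 then (1 : L) else 0) v)).isClosed_of_isOpen hKo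
  have hnhds : ∀ (O : Set ((UnitaryGroup.cmDatum L 2 (Matrix.of fun i j : Fin 2 => if i.val + j.val + 1 = 2 then (1 : L) else 0)).Local v × (UnitaryGroup.cmDatum L 1 (Matrix.of fun i j : Fin 1 => if i.val + j.val + 1 = 1 then (1 : L) else 0)).Local v)) (x : (UnitaryGroup.cmDatum L 2 (Matrix.of fun i j : Fin 2 => if i.val + j.val + 1 = 2 then (1 : L) else 0)).Local v × (UnitaryGroup.cmDatum L 1 (Matrix.of fun i j : Fin 1 => if i.val + j.val + 1 = 1 then (1 : L) else 0)).Local v), IsOpen O → x ∈ O → ∃ P : Set ((UnitaryGroup.cmDatum L 2 (Matrix.of fun i j : Fin 2 => if i.val + j.val + 1 = 2 then (1 : L) else 0)).Local v × (UnitaryGroup.cmDatum L 1 (Matrix.of fun i j : Fin 1 => if i.val + j.val + 1 = 1 then (1 : L) else 0)).Local v), IsOpen P ∧ IsCompact P ∧ IsClosed P ∧ x ∈ P ∧ P ⊆ O :=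
    fun O x hO hx => exists_isOpen_isCompact_isClosed_nhds_subset hKc hKo hKcl (Subgroup.one_mem _) hO hx
  -- the predicate «over `z`» and its class invariance (★ p23)
  obtain ⟨P, hP⟩ : ∃ P : (UnitaryGroup.cmDatum L 2 (Matrix.of fun i j : Fin 2 => if i.val + j.val + 1 = 2 then (1 : L) else 0)).Local v × (UnitaryGroup.cmDatum L 1 (Matrix.of fun i j : Fin 1 => if i.val + j.val + 1 = 1 then (1 : L) else 0)).Local v → Prop,
      ∀ γ, P γ ↔ (((((γ * z⁻¹).1).val : GL (Fin 2) (UnitaryGroup.LocalRing L v)).val - 1) ^ 2 = 0 ∧ (γ * z⁻¹).2 = 1) := ⟨_, fun _ => Iff.rfl⟩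
  have hPconj : ∀ (a b : (UnitaryGroup.cmDatum L 2 (Matrix.of fun i j : Fin 2 => if i.val + j.val + 1 = 2 then (1 : L) else 0)).Local v × (UnitaryGroup.cmDatum L 1 (Matrix.of fun i j : Fin 1 => if i.val + j.val + 1 = 1 then (1 : L) else 0)).Local v), IsConj a b → (P a ↔ P b) := by
    intro a b hab
    obtain ⟨x, rfl⟩ := isConj_iff.1 hab
    rw [hP, hP]
    exact (centralUnipotent_conj_iff hz a x).symm
  -- conjugates of the central `z` are `z`
  have hzconj : ∀ b : (UnitaryGroup.cmDatum L 2 (Matrix.of fun i j : Fin 2 => if i.val + j.val + 1 = 2 then (1 : L) else 0)).Local v × (UnitaryGroup.cmDatum L 1 (Matrix.of fun i j : Fin 1 => if i.val + j.val + 1 = 1 then (1 : L) else 0)).Local v, IsConj z b → b = z := by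
    intro b hb
    obtain ⟨x, rfl⟩ := isConj_iff.1 hb
    have h : x * z = z * x := Subgroup.mem_center_iff.1 hz x
    rw [h, mul_inv_cancel_right]
  -- stratum index and lower unions
  obtain ⟨st, hst⟩ : ∃ st : (UnitaryGroup.cmDatum L 2 (Matrix.of fun i j : Fin 2 => if i.val + j.val + 1 = 2 then (1 : L) else 0)).Local v × (UnitaryGroup.cmDatum L 1 (Matrix.of fun i j : Fin 1 => if i.val + j.val + 1 = 1 then (1 : L) else 0)).Local v → ℕ, ∀ γ, st γ = if γ = z then 0 else 1 := ⟨_, fun _ => rfl⟩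
  obtain ⟨lower, hlower⟩ : ∃ lower : (UnitaryGroup.cmDatum L 2 (Matrix.of fun i j : Fin 2 => if i.val + j.val + 1 = 2 then (1 : L) else 0)).Local v × (UnitaryGroup.cmDatum L 1 (Matrix.of fun i j : Fin 1 => if i.val + j.val + 1 = 1 then (1 : L) else 0)).Local v → Set ((UnitaryGroup.cmDatum L 2 (Matrix.of fun i j : Fin 2 => if i.val + j.val + 1 = 2 then (1 : L) else 0)).Local v × (UnitaryGroup.cmDatum L 1 (Matrix.of fun i j : Fin 1 => if i.val + j.val + 1 = 1 then (1 : L) else 0)).Local v), ∀ x, lower x = if x = z then ∅ else {z} := ⟨_, fun _ => rfl⟩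
  have hstconj : ∀ a b : (UnitaryGroup.cmDatum L 2 (Matrix.of fun i j : Fin 2 => if i.val + j.val + 1 = 2 then (1 : L) else 0)).Local v × (UnitaryGroup.cmDatum L 1 (Matrix.of fun i j : Fin 1 => if i.val + j.val + 1 = 1 then (1 : L) else 0)).Local v, IsConj a b → st a = st b := by
    intro a b hab
    rw [hst, hst]
    by_cases ha : a = z
    · subst ha
      rw [if_pos rfl, if_pos (hzconj b hab)]
    · have hb : b ≠ z := fun hb => ha (by subst hb; exact (hzconj a hab.symm))
      rw [if_neg ha, if_neg hb]
  have hlo : ∀ x : (UnitaryGroup.cmDatum L 2 (Matrix.of fun i j : Fin 2 => if i.val + j.val + 1 = 2 then (1 : L) else 0)).Local v × (UnitaryGroup.cmDatum L 1 (Matrix.of fun i j : Fin 1 => if i.val + j.val + 1 = 1 then (1 : L) else 0)).Local v, IsOpen (lower x)ᶜ := fun x => by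
    rw [hlower]
    split_ifs
    · rw [Set.compl_empty]; exact isOpen_univ
    · exact isClosed_singleton.isOpen_compl
  have hxlo : ∀ x : (UnitaryGroup.cmDatum L 2 (Matrix.of fun i j : Fin 2 => if i.val + j.val + 1 = 2 then (1 : L) else 0)).Local v × (UnitaryGroup.cmDatum L 1 (Matrix.of fun i j : Fin 1 => if i.val + j.val + 1 = 1 then (1 : L) else 0)).Local v, x ∉ lower x := fun x => by
    rw [hlower]
    split_ifs with h
    · exact Set.notMem_empty _
    · exact h
  have hle : ∀ x ∈ {γ : (UnitaryGroup.cmDatum L 2 (Matrix.of fun i j : Fin 2 => if i.val + j.val + 1 = 2 then (1 : L) else 0)).Local v × (UnitaryGroup.cmDatum L 1 (Matrix.of fun i j : Fin 1 => if i.val + j.val + 1 = 1 then (1 : L) else 0)).Local v | P γ}, ∀ y ∈ {γ : (UnitaryGroup.cmDatum L 2 (Matrix.of fun i j : Fin 2 => if i.val + j.val + 1 = 2 then (1 : L) else 0)).Local v × (UnitaryGroup.cmDatum L 1 (Matrix.of fun i j : Fin 1 => if i.val + j.val + 1 = 1 then (1 : L) else 0)).Local v | P γ}, y ∉ lower x →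 st x ≤ st y := by
    intro x _ y _ hy
    rw [hst, hst]
    by_cases hx : x = z
    · rw [if_pos hx]; exact Nat.zero_le _
    · rw [hlower, if_neg hx] at hy
      have hy' : y ≠ z := hy
      rw [if_neg hx, if_neg hy']
  have hst_iff : ∀ a b : (UnitaryGroup.cmDatum L 2 (Matrix.of fun i j : Fin 2 => if i.val + j.val + 1 = 2 then (1 : L) else 0)).Local v × (UnitaryGroup.cmDatum L 1 (Matrix.of fun i j : Fin 1 => if i.val + j.val + 1 = 1 then (1 : L) else 0)).Local v, st a = st b → (a = z ↔ b = z) := by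
    intro a b h
    rw [hst, hst] at h
    by_cases ha : a = z <;> by_cases hb : b = z <;> simp only [ha, hb, if_true, if_false] at h ⊢ <;> omega
  -- the (S2₂) sets
  have hS2 : ∀ u : (UnitaryGroup.cmDatum L 2 (Matrix.of fun i j : Fin 2 => if i.val + j.val + 1 = 2 then (1 : L) else 0)).Local v × (UnitaryGroup.cmDatum L 1 (Matrix.of fun i j : Fin 1 => if i.val + j.val + 1 = 1 then (1 : L) else 0)).Local v, P u → ∃ V : Set ((UnitaryGroup.cmDatum L 2 (Matrix.of fun i j : Fin 2 => if i.val + j.val + 1 = 2 then (1 : L) else 0)).Local v × (UnitaryGroup.cmDatum L 1 (Matrix.of fun i j : Fin 1 => if i.val + j.val + 1 = 1 then (1 : L) else 0)).Local v), IsOpen V ∧ ∀ γ : (UnitaryGroup.cmDatum L 2 (Matrix.of fun i j : Fin 2 => if i.val + j.val + 1 = 2 then (1 : L) else 0)).Local v × (UnitaryGroup.cmDatum L 1 (Matrix.of fun i j : Fin 1 => if i.val + j.val + 1 = 1 then (1 : L) else 0)).Local v, (P γ ∧ (γ = z ↔ u = z)) → (γ ∈ V ↔ IsConj u γ) := by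
    intro u hu
    rw [hP] at hu
    obtain ⟨V, hVo, hV⟩ := exists_isOpen_forall_centralUnipotent_mem_iff_isConj L v w hsub hz u hu
    exact ⟨V, hVo, fun γ hγ => hV γ ⟨(hP γ).1 hγ.1, hγ.2⟩⟩
  choose! V hVo hV using hS2
  have hV' : ∀ x ∈ {γ : (UnitaryGroup.cmDatum L 2 (Matrix.of fun i j : Fin 2 => if i.val + j.val + 1 = 2 then (1 : L) else 0)).Local v × (UnitaryGroup.cmDatum L 1 (Matrix.of fun i j : Fin 1 => if i.val + j.val + 1 = 1 then (1 : L) else 0)).Local v | P γ}, ∀ y ∈ {γ : (UnitaryGroup.cmDatum L 2 (Matrix.of fun i j : Fin 2 => if i.val + j.val + 1 = 2 then (1 : L) else 0)).Local v × (UnitaryGroup.cmDatum L 1 (Matrix.of fun i j : Fin 1 => if i.val + j.val + 1 = 1 then (1 : L) else 0)).Local v | P γ}, st y = st x → (y ∈ V x ↔ IsConj x y) :=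
    fun x hx y hy h => hV x hx y ⟨hy, hst_iff y x h⟩
  -- the abstract Bernstein–Zelevinsky lemma
  obtain ⟨gref, hgs, hdet⟩ := exists_indicator_det_classOrbitalIntegral_ne_zero_of_strata S mU hmU hRao hnhds {γ : (UnitaryGroup.cmDatum L 2 (Matrix.of fun i j : Fin 2 => if i.val + j.val + 1 = 2 then (1 : L) else 0)).Local v × (UnitaryGroup.cmDatum L 1 (Matrix.of fun i j : Fin 1 => if i.val + j.val + 1 = 1 then (1 : L) else 0)).Local v | P γ}
    (fun u hu => by rw [Set.mem_setOf_eq, hP]; exact hS u hu) (fun a b hab ha => (hPconj a b hab).1 ha) st hstconj lower hlo hxlo hle V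
    (fun x hx => hVo x hx) hV'
  -- invert: Kronecker dual pieces on `↥S`, then the total dress
  obtain ⟨fdS, hfdS, hkron, -⟩ := exists_dualPieces_of_det_ne_zero S mU hRao gref hgs hdet
  exact exists_dualPieces_total_of_subtype S mU fdS hfdS (fun u => by simpa using hkron u u)
    (fun u u' hne => by simpa [if_neg hne] using hkron u u')

end Summit.HodgeConjecture.HodgeConjecture.Cruxes.H413.K2E3CentralUnipotentDualPieces

end
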